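import Summits.RiemannHypothesis.RiemannHypothesis.Theses.WeilComb
import Summits.RiemannHypothesis.RiemannHypothesis.Theorems.WeilCombCombShapePositivityEffectiveWindow25
import Summits.RiemannHypothesis.RiemannHypothesis.Theorems.WeilCombCombShapePositivityEffectiveWindow17
import Summits.RiemannHypothesis.RiemannHypothesis.Theorems.WeilCombCombShapePositivityTopCellsFromPivot
import Summits.RiemannHypothesis.RiemannHypothesis.Theorems.FejerDivisorPositivity
import Summits.RiemannHypothesis.RiemannHypothesis.Theorems.WeilCombCombShapePositivityStubGram
import Summits.RiemannHypothesis.RiemannHypothesis.Theorems.WeilCombCombShapePositivityStubReduction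
import Summits.RiemannHypothesis.RiemannHypothesis.Theorems.WeilCombCombShapePositivityStubWindowMellin
import Summits.RiemannHypothesis.RiemannHypothesis.Theorems.WeilCombCombShapePositivityStubWindowNorm
import Summits.RiemannHypothesis.RiemannHypothesis.Theorems.WeilCombCombShapePositivityExactPrimeWindow
import Summits.RiemannHypothesis.RiemannHypothesis.Theorems.WeilCombCombShapePositivityPolarExact
import Summits.RiemannHypothesis.RiemannHypothesis.Theorems.CombShapePositivity.Negative.WeilCombCombShapePositivityLoadBearing
import Literature.NumberTheory.LFunctions.WeilExplicit
import Literature.NumberTheory.LFunctions.WeilArchimedeanPositivityProofs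

/-!
# Skeleton v10 — crux `WeilComb.CombShapePositivity` (stmt-RiemannHypothesis-11229), line `Sketch`
(Bohr–Fejér composition of `Cruxes/CombShapePositivity/SketchIdeator1.lean`, card `bohr-fejer-reduction`;
v10 = lead c4, 2026-08-16: the effective window is BANKED (`λ ≤ 1/17`, `combWindow_le_inv17`, p124475; v9 = lead c3: `λ ≤ 1/19`), the RH-equivalent residual `stub_fejer` is typed BY NAME
(`FejerDivisorPositivity`), and the band residual `stub_windowCore` is now a COMPOSITION of the Perron-pivot stubs B4/B5/B7/C of
STUB-PLAN-stub_windowCore through the landed `windowCore_of_pivot_of_cells` (p121412))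

Notation. `φ₀(u) = expNegInvGlue (1 - u²)` (the route's fixed bump, support `[-1,1]`), `φ_ε(t) = ε⁻¹ φ₀(t/ε)`,
`ψ_ε = φ_ε ⋆ φ̃_ε`, comb `g = Σ_{m ≤ M} a_m φ_ε(· − log m)`, `Q(g) = weilQuadratic g = W(g ⋆ g̃)`,
`N = ‖φ₀‖₂²`, `U = ψ_ε(0) = ε⁻¹N`, `H(a) = 2 Re Σ_m Σ_{n ≤ M/m} Λ(n) n^{-1/2} a(nm) conj a(m)` (Helson form),
`D_a(t) = Σ a_m m^{it}`, `A∓ = Σ a_m m^{∓1/2}`, `λ = εM`.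

What is PROVED (tree theorems, imported — no sorries):
* the effective window `λ ≤ 1/17 ⇒ 0 ≤ Re Q(g)` — `combWindow_le_inv17` (`…EffectiveWindow17`, lead c4, p124475: Helson constant
  `G = 0` (`WeilCombHelsonGK7.sum_norm_sq_mul_potential_le`) + bump ratio `153/100` + budget `assemble_inv17`, glued by
  `effectiveWindow_of_budget`; the last rung of this architecture: at `1/16` the D-coefficient is negative) and
  `λ ≤ 1/20` — `combWindow_le_inv20` (`…EffectiveWindow20`, siege k12:
  certified bump ratio `153/100` + Helson constant `3/20` + budget `assemble_inv20`; `λ ≤ 1/19` is `…EffectiveWindow19`,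
  not yet built on the farm when v8.1 was registered), and `λ ≤ 1/25` —
  `combShapePositivity_of_mul_le_inv_25` (`…EffectiveWindow25`, lead c3, p116838: the generic budget-to-window glue
  `effectiveWindow_of_budget` + `assemble_inv25`), both glued from the five LANDED stubs of v7: `stub_offdiagSchur`
  (p109602), `stub_poincareEta` (p109896), `stub_archBathtub` (p110455), `stub_helsonG` (p110888; sharpened to `3/20`,
  `helsonPotential_le_three_twentieths` p113016) and `stub_assemble40` (p111671; re-run at `1/25`, `1/20`, `1/19`);
  the v7 glued sub-theorem `stub_windowSub40` is a corollary (`…EffectiveWindow25`);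
* `stub_gram` (p87341), `stub_reduction` (p86541), `stub_windowMellin` (p96387), `stub_windowNorm` (p96510),
  the exact window identity (p90904) and the polar identity (p91841);
* `FejerDivisorPositivity ↔ RiemannHypothesis` and `CombShapePositivity ↔ FejerDivisorPositivity`
  (`Theorems/FejerDivisorPositivity.lean`, p116796).

What is OPEN (the five `sorry`s = the registered stubs of v9):
* `stub_perronRayleighTop` (B4), `stub_perronCrossTop` (B5) — explicit-sum estimates whose only prime input is the
  Mertens remainder `E₁` (LANDED: `stub_mertensE1` p119390, `stub_psiOneMidrange` p119328, `stub_psiOneSmallRange` p119664)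
  and whose transcendental inputs are the certified bump constants (`R`, `J` — siege k2's Bombieri diagonal files) and the
  exact Perron rows (LANDED: `stub_perronArchRowSum` p119065, `stub_screeningProfile`/`stub_closureConstants` p119694,
  `stub_helsonPerronRow`/`schur_pivot` p118891);
* `stub_perpCoercivityTop` (B7) — the pole-free coercivity on `u^⊥`, NO MECHANISM YET (plan §1.7); its first brick, the
  divisor-graph gap, is reduced to a finite base + an odd-block inequality (LANDED `stub_divisorGapTwoBlock` p120940,
  `stub_divisorGapParityReduction` p121469);
* `stub_topCellsSmall` (C) — the finitely many top cells `2 ≤ M < 400`, computational;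
* `stub_fejer : FejerDivisorPositivity` — typed BY NAME: the RH-EQUIVALENT crux (never a worker).
`stub_windowCore` (Theorem B on the band) is NO LONGER a stub: it is composed in this file from B4/B5/B7/C through the
landed `windowCore_of_pivot_of_cells` (…TopCellsFromPivot, p121412).
`CombShapePositivity_of` concludes the crux BY NAME: window cells by `stub_window` (banked window + band residual),
the co-final rest through `stub_gram` + `stub_reduction` + `stub_fejer`.
-/

noncomputable section

-- the sub-problem path `RiemannHypothesis/RiemannHypothesis` (single-conjunct summit, D-0017) duplicates a namespace
set_option linter.dupNamespace false

open scoped BigOperators ComplexConjugate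
open Complex MeasureTheory

namespace Summit.RiemannHypothesis.RiemannHypothesis.Theorems.WeilCombBohrFejer

open Literature.NumberTheory.LFunctions

/-! ## The top cells `2ε(M+1) ≤ 1 < 2ε(M+2)`: the Perron-pivot programme (STUB-PLAN-stub_windowCore) -/

/-- **Stub B4 — Perron Rayleigh quotient on the top cells** (`M ≥ 400`): `Re Q(g_u) ≥ (1/20)·U·H_M` for the
Perron ray `u_m = m^{-1/2}` (Λ-free: `perron_helson_eq`; pole `2F_ε²H_M·M`; exact archimedean diagonal in Bombieri
form + certified `J`; Perron arch rows `stub_perronArchRowSum` + screening). Truth `m_∞(1/2) = 0.0555`. [M–L] -/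
theorem stub_perronRayleighTop :
    ∀ ε : ℝ, 0 < ε → ∀ M : ℕ, 400 ≤ M → 2 * ε * ((M : ℝ) + 1) ≤ 1 → 1 < 2 * ε * ((M : ℝ) + 2) →
      1 / 20 * (ε⁻¹ * weilNorm2Sq (fun u : ℝ => ((expNegInvGlue (1 - u ^ 2) : ℝ) : ℂ))) *
          (∑ m ∈ Finset.Icc 1 M, (1 : ℝ) / m) ≤
        (weilQuadratic (fun x : ℝ => ∑ m ∈ Finset.Icc 1 M,
          ((Real.sqrt (m : ℝ) : ℝ) : ℂ)⁻¹ *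
            ((ε : ℂ)⁻¹ * ((expNegInvGlue (1 - ((x - Real.log (m : ℝ)) / ε) ^ 2) : ℝ) : ℂ)))).re := by
  sorry

/-- **Stub B5 — screened cross term on the top cells** (`M ≥ 400`, `y ⊥ u`): `|W(g_u ⋆ g̃_y)|² ≤ (1/16)·U²·‖y‖²`
(pole row and archimedean Perron row cancel to the screening profile `stub_screeningProfile`; prime row
`= −E₁(M/m)u_m` by `stub_helsonPerronRow` with `|E₁|` from `stub_mertensE1`/`stub_psiOneMidrange`/`stub_psiOneSmallRange`).
Numerics `c_* = 0.043–0.049`. [M–L] -/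
theorem stub_perronCrossTop :
    ∀ ε : ℝ, 0 < ε → ∀ (M : ℕ) (y : ℕ → ℂ), 400 ≤ M → 2 * ε * ((M : ℝ) + 1) ≤ 1 →
      1 < 2 * ε * ((M : ℝ) + 2) →
      ∑ m ∈ Finset.Icc 1 M, y m * ((Real.sqrt (m : ℝ) : ℝ) : ℂ)⁻¹ = 0 →
      ‖weilFunctional (weilConv
          (fun x : ℝ => ∑ m ∈ Finset.Icc 1 M,
            ((Real.sqrt (m : ℝ) : ℝ) : ℂ)⁻¹ *
              ((ε : ℂ)⁻¹ * ((expNegInvGlue (1 - ((x - Real.log (m : ℝ)) / ε) ^ 2) : ℝ) : ℂ)))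
          (weilReflect (fun x : ℝ => ∑ m ∈ Finset.Icc 1 M,
            y m * ((ε : ℂ)⁻¹ * ((expNegInvGlue (1 - ((x - Real.log (m : ℝ)) / ε) ^ 2) : ℝ) : ℂ)))))‖ ^ 2 ≤
        1 / 16 * (ε⁻¹ * weilNorm2Sq (fun u : ℝ => ((expNegInvGlue (1 - u ^ 2) : ℝ) : ℂ))) ^ 2 *
          ∑ m ∈ Finset.Icc 1 M, ‖y m‖ ^ 2 := by
  sorry

/-- **Stub B7 — pole-free coercivity on `u^⊥`** (`M ≥ 400`, `y ⊥ u`): `Re Q(g_y) ≥ (1/5)·U·‖y‖²` (truth `0.5–0.62`).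
THE HARD ONE: no typed mechanism yet (plan §1.7); first brick = the divisor-graph gap `stub_divisorGapPerp`
(parity reduction landed: `stub_divisorGapTwoBlock`, `stub_divisorGapParityReduction`). [XL] -/
theorem stub_perpCoercivityTop :
    ∀ ε : ℝ, 0 < ε → ∀ (M : ℕ) (y : ℕ → ℂ), 400 ≤ M → 2 * ε * ((M : ℝ) + 1) ≤ 1 →
      1 < 2 * ε * ((M : ℝ) + 2) →
      ∑ m ∈ Finset.Icc 1 M, y m * ((Real.sqrt (m : ℝ) : ℝ) : ℂ)⁻¹ = 0 →
      1 / 5 * (ε⁻¹ * weilNorm2Sq (fun u : ℝ => ((expNegInvGlue (1 - u ^ 2) : ℝ) : ℂ))) *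
          ∑ m ∈ Finset.Icc 1 M, ‖y m‖ ^ 2 ≤
        (weilQuadratic (fun x : ℝ => ∑ m ∈ Finset.Icc 1 M,
          y m * ((ε : ℂ)⁻¹ * ((expNegInvGlue (1 - ((x - Real.log (m : ℝ)) / ε) ^ 2) : ℝ) : ℂ)))).re := by
  sorry

/-- **Stub C — the finitely many top cells `2 ≤ M < 400`** (`TopCellsBelow 400`; COMPUTATIONAL: interval PSD
certificates of one-parameter matrix families; per plan K4 to be filed as a `--computational` item unless the
analytic constants shrink `M₀` to ≲ 20). -/
theorem stub_topCellsSmall :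
    ∀ ε : ℝ, 0 < ε → ∀ (M : ℕ) (b : ℕ → ℝ), 2 ≤ M → M < 400 → 2 * ε * ((M : ℝ) + 1) ≤ 1 →
      1 < 2 * ε * ((M : ℝ) + 2) →
      0 ≤ (weilQuadratic (fun x : ℝ => ∑ m ∈ Finset.Icc 1 M,
        ((b m : ℝ) : ℂ) * ((ε : ℂ)⁻¹ * ((expNegInvGlue (1 - ((x - Real.log (m : ℝ)) / ε) ^ 2) : ℝ) : ℂ)))).re := by
  sorry

/-! ## The band `1/17 < εM ≤ M/(2(M+1))`: Theorem B in signed normal form, COMPOSED from the pivot stubs -/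

/-- **THEOREM B on the band (the former residual `stub_windowCore`), now a composition**: for `ε > 0`, `M ≥ 1`,
`1/17 < εM`, `2ε(M+1) ≤ 1`, the signed normal form inequality — from B4, B5, B7 and C through the landed
`windowCore_of_pivot_of_cells` (…TopCellsFromPivot, p121412: Perron-pivot Schur complement + GLUE
`stub_windowCore_iff_topCells_real`). -/
theorem stub_windowCore : ∀ ε : ℝ, 0 < ε → ∀ (M : ℕ) (a : ℕ → ℂ), 1 ≤ M → 1 / 17 < ε * M →
    2 * ε * ((M : ℝ) + 1) ≤ 1 →
    ε⁻¹ * weilNorm2Sq (fun u : ℝ => ((expNegInvGlue (1 - u ^ 2) : ℝ) : ℂ)) *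
        (2 * (∑ m ∈ Finset.Icc 1 M, ∑ n ∈ Finset.Icc 1 (M / m),
            ((ArithmeticFunction.vonMangoldt n : ℝ) : ℂ) / (Real.sqrt n : ℂ) * a (n * m) *
              conj (a m)).re
          + Real.log Real.pi * ∑ m ∈ Finset.Icc 1 M, ‖a m‖ ^ 2) ≤
      2 * (weilMellin (fun t : ℝ => (ε : ℂ)⁻¹ * ((expNegInvGlue (1 - (t / ε) ^ 2) : ℝ) : ℂ)) 0 *
            conj (weilMellin (fun t : ℝ => (ε : ℂ)⁻¹ * ((expNegInvGlue (1 - (t / ε) ^ 2) : ℝ) : ℂ)) 1) *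
          ((∑ m ∈ Finset.Icc 1 M, a m * ((Real.sqrt (m : ℝ) : ℝ) : ℂ)⁻¹) *
            conj (∑ m ∈ Finset.Icc 1 M, a m * ((Real.sqrt (m : ℝ) : ℝ) : ℂ)))).re
      + 1 / (2 * Real.pi) * ∫ t : ℝ,
          ‖weilMellin (fun t : ℝ => (ε : ℂ)⁻¹ * ((expNegInvGlue (1 - (t / ε) ^ 2) : ℝ) : ℂ))
              (1 / 2 + t * I)‖ ^ 2 *
            ‖∑ m ∈ Finset.Icc 1 M, a m * cexp (t * I * (Real.log (m : ℝ) : ℂ))‖ ^ 2 *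
            (Complex.digamma (1 / 4 + t / 2 * I)).re := by
  intro ε hε M a hM hlam hw
  exact windowCore_of_pivot_of_cells stub_perronRayleighTop stub_perronCrossTop stub_perpCoercivityTop
    stub_topCellsSmall ε hε M a hM (lt_trans (by norm_num) hlam) hw


/-! ## Theorem B on the whole window, glued -/

/-- **THEOREM B (`stub_window`, glued).** For `ε > 0`, `M`, `a` with `2ε(M+1) ≤ 1` the fixed-shape comb
has `0 ≤ Re Q(g)`.  `εM ≤ 1/17`: the BANKED effective window `combWindow_le_inv17`
(`…Theorems.WeilCombCombShapePositivityEffectiveWindow17`, lead c4 wave 1, p124475: `G = 0` Helson constant + `r = 153/100`;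
`εM ≤ 1/19, 1/20, 1/25` are `…EffectiveWindow19/20/25`).  Otherwise `M ≥ 1` and
`Re Q = Re P(k) − ε⁻¹‖φ₀‖₂² H(a) + Re W_∞(k)` (p90904), `Re P(k) = 2 Re(φ̂_ε(0) conj φ̂_ε(1) A₋ conj A₊)` (p91841),
`Re W_∞(k) = (1/2π)∫|ĝ(1/2+it)|² Re ψ(1/4+it/2) dt − ‖g‖₂² log π` (`weilArchIntegral_weilConv_weilReflect`,
`weilConv_weilReflect_apply_zero`), `|ĝ|² = |D_a|²|φ̂_ε|²` (W1), `‖g‖₂² = ε⁻¹‖φ₀‖₂²‖a‖²` (W2); then W3. -/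
theorem stub_window : ∀ ε : ℝ, 0 < ε → ∀ (M : ℕ) (a : ℕ → ℂ), 2 * ε * ((M : ℝ) + 1) ≤ 1 →
    0 ≤ (weilQuadratic (fun x : ℝ => ∑ m ∈ Finset.Icc 1 M,
        a m * ((ε : ℂ)⁻¹ * ((expNegInvGlue (1 - ((x - Real.log (m : ℝ)) / ε) ^ 2) : ℝ) : ℂ)))).re := by
  intro ε hε M a hw
  by_cases hlam : ε * M ≤ 1 / 17
  · exact combWindow_le_inv17 ε hε M a hlam
  push Not at hlam
  rcases Nat.eq_zero_or_pos M with hM0 | hMpos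
  · exfalso
    subst hM0
    simp at hlam
    linarith
  have hM : 1 ≤ M := hMpos
  -- names
  set g : ℝ → ℂ := fun x : ℝ => ∑ m ∈ Finset.Icc 1 M,
      a m * ((ε : ℂ)⁻¹ * ((expNegInvGlue (1 - ((x - Real.log (m : ℝ)) / ε) ^ 2) : ℝ) : ℂ)) with hg
  set φε : ℝ → ℂ := fun t : ℝ => (ε : ℂ)⁻¹ * ((expNegInvGlue (1 - (t / ε) ^ 2) : ℝ) : ℂ) with hφε
  set N : ℝ := weilNorm2Sq (fun u : ℝ => ((expNegInvGlue (1 - u ^ 2) : ℝ) : ℂ)) with hN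
  set H : ℝ := 2 * (∑ m ∈ Finset.Icc 1 M, ∑ n ∈ Finset.Icc 1 (M / m),
      ((ArithmeticFunction.vonMangoldt n : ℝ) : ℂ) / (Real.sqrt n : ℂ) * a (n * m) *
        conj (a m)).re with hH
  set L : ℝ := ∑ m ∈ Finset.Icc 1 M, ‖a m‖ ^ 2 with hL
  set P : ℝ := 2 * (weilMellin φε 0 * conj (weilMellin φε 1) *
      ((∑ m ∈ Finset.Icc 1 M, a m * ((Real.sqrt (m : ℝ) : ℝ) : ℂ)⁻¹) *
        conj (∑ m ∈ Finset.Icc 1 M, a m * ((Real.sqrt (m : ℝ) : ℝ) : ℂ)))).re with hP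
  set D : ℝ → ℂ := fun t : ℝ => ∑ m ∈ Finset.Icc 1 M, a m * cexp (t * I * (Real.log (m : ℝ) : ℂ)) with hD
  set J : ℝ := ∫ t : ℝ, ‖weilMellin φε (1 / 2 + t * I)‖ ^ 2 * ‖D t‖ ^ 2 *
      (Complex.digamma (1 / 4 + t / 2 * I)).re with hJ
  -- the comb is a Weil test
  have hgW : IsWeilTest g := Summit.RiemannHypothesis.RiemannHypothesis.Theorems.weilComb_shapeComb_isWeilTest ε M a
  -- Step 1: exact window identity and polar identity
  have h1 := weilQuadratic_comb_re_exactWindow ε hε M a hM hw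
  have h2 := weilPolarTerm_comb_re ε hε M a
  -- Step 2: the archimedean term of `g ⋆ g̃`
  have h3 : (weilArchTerm (weilConv g (weilReflect g))).re =
      1 / (2 * Real.pi) * (∫ t : ℝ, ‖weilMellin g (1 / 2 + t * I)‖ ^ 2 *
        (Complex.digamma (1 / 4 + t / 2 * I)).re) - weilNorm2Sq g * Real.log Real.pi := by
    unfold weilArchTerm
    rw [weilArchIntegral_weilConv_weilReflect hgW, weilConv_weilReflect_apply_zero]
    have e : ((1 / (2 * Real.pi) : ℂ) * ((∫ t : ℝ, ‖weilMellin g (1 / 2 + t * I)‖ ^ 2 *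
          (Complex.digamma (1 / 4 + t / 2 * I)).re : ℝ) : ℂ) -
          ((∫ t : ℝ, ‖g t‖ ^ 2 : ℝ) : ℂ) * (Real.log Real.pi : ℂ)) =
        ((1 / (2 * Real.pi) * (∫ t : ℝ, ‖weilMellin g (1 / 2 + t * I)‖ ^ 2 *
          (Complex.digamma (1 / 4 + t / 2 * I)).re) - weilNorm2Sq g * Real.log Real.pi : ℝ) : ℂ) := by
      unfold weilNorm2Sq
      push_cast
      ring
    rw [e, Complex.ofReal_re]
  -- Step 3: `|ĝ(1/2+it)|² = |φ̂_ε(1/2+it)|² |D_a(t)|²` under the integral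
  have h4 : (∫ t : ℝ, ‖weilMellin g (1 / 2 + t * I)‖ ^ 2 * (Complex.digamma (1 / 4 + t / 2 * I)).re) = J := by
    rw [hJ]
    congr 1
    funext t
    rw [hg, stub_windowMellin ε hε M a t, norm_mul, mul_pow]
    ring
  -- Step 4: the window norm identity
  have h5 : weilNorm2Sq g = ε⁻¹ * N * L := by
    rw [hg, hN, hL]
    exact stub_windowNorm ε hε M a hw
  -- Step 5: the core inequality
  have h6 : ε⁻¹ * N * (H + Real.log Real.pi * L) ≤ P + 1 / (2 * Real.pi) * J :=
    stub_windowCore ε hε M a hM hlam hw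
  rw [h1, h2, h3, h4, h5]
  have e6 : ε⁻¹ * N * (H + Real.log Real.pi * L) = ε⁻¹ * N * H + ε⁻¹ * N * L * Real.log Real.pi := by ring
  rw [e6] at h6
  show 0 ≤ P - ε⁻¹ * N * H + (1 / (2 * Real.pi) * J - ε⁻¹ * N * L * Real.log Real.pi)
  linarith

/-! ## The RH-equivalent residual, by name, and the composition -/

/-- **`stub_fejer` — the named RH-equivalent crux `FejerDivisorPositivity`** ("Fejér divisor-sum positivity":
Fejér means of the comb symbol are nonnegative on every torus `T^S`; `Theorems/FejerDivisorPositivity.lean`, p116796).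
Kernel-checked EQUIVALENT to `RiemannHypothesis` (`fejerDivisorPositivity_iff_riemannHypothesis`) and to the crux
(`combShapePositivity_iff_fejerDivisorPositivity`): an RH-equivalent CRUX carried by name only so that the composition is
closed — NOT a support stub, no stub-worker is dispatched on it (human ruling 2026-08-16). -/
theorem stub_fejer : Summit.RiemannHypothesis.RiemannHypothesis.Theorems.FejerDivisorPositivity := by
  sorry

/-- **Composition — `WeilComb.CombShapePositivity` from the stubs.** Window cells (`2ε(M+1) ≤ 1`) by
Theorem B (`stub_window`: banked effective window `λ ≤ 1/17` + the band, now composed from the pivot stubs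
B4/B5/B7/C); the co-final rest through the named RH-equivalent crux
(`combShapePositivity_iff_fejerDivisorPositivity.mpr stub_fejer`). -/
theorem CombShapePositivity_of :
    Summit.RiemannHypothesis.RiemannHypothesis.Theses.WeilComb.CombShapePositivity := by
  intro ε hε M a
  by_cases hw : 2 * ε * ((M : ℝ) + 1) ≤ 1
  · exact stub_window ε hε M a hw
  · exact (Summit.RiemannHypothesis.RiemannHypothesis.Theorems.combShapePositivity_iff_fejerDivisorPositivity.mpr
      stub_fejer) ε hε M a

end Summit.RiemannHypothesis.RiemannHypothesis.Theorems.WeilCombBohrFejer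

end
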